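import Summits.CriticalPhenomena.PercolationContinuityZ3.Theorems.PercNearOneGluingNoHeavyLowerTailSuperTerminalP3LamPortPieces
import HarnessLib

/-!
# The PORT PART of a weighted graph carries every row `P3_λ`, `λ ≥ 3/2` (quotable form of `…SuperTerminalP3LamPortPieces`)

Support file for crux `stmt-CriticalPhenomena-4575` (`NoHeavyLowerTail`), seat `prim-l12-p1` gen 33 (`--supports stmt-CriticalPhenomena-4575`);
sequel of `…SuperTerminalP3LamPortPieces` (`p3lam_of_portPieces`), in the style of `…SuperTerminalPrimeReduction`.  No definitions, no sorries,
standard axioms.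

Bond percolation `μ = prodBernoulli w` on a finite vertex type `V`, pairwise distinct `s a b c`; `F = {s↔a} ∩ {s↮b}`, `T = {s,a,b}`; the row
`P3_λ` is `μ(F)·μ(c ↔ T) ≤ λ·μ(F ∩ c ↔ T)`.  The PORT PART of `w` keeps the pairs inside `{s,a,b,c}` and every non-loop pair with an
endpoint `x ∉ {s,a,b,c}` joined to the port `c` by a path of pairs of non-zero weight avoiding `{s,a,b}`, and gives weight `0` to every
other pair (stated inline with `SimpleGraph.fromRel`, no definitions).

* `p3lam_of_sabPairs_zero` — for every `λ ≥ 3/2` the three pairs inside `{s,a,b}` are irrelevant to `P3_λ` (set them to `0`);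
* `p3lam_of_portPart` — **for every `λ ≥ 3/2` (in particular the SHARP row `λ = 3/2`), `P3_λ` for the port part of `w` implies `P3_λ`
  for `w`**: the components of `G ∖ {s,a,b}` that do not contain the port — with all their attachments to `s, a, b` — never matter, so a
  counterexample to the sharp row with the fewest active vertices has `G ∖ {s,a,b}` connected.  (For `λ ≥ 8/5` the finer reduction to
  `{s,a,b,c}`-primes is `SuperTerminalPrimeReduction.p3lam_of_primes`; at `λ = 3/2` the pieces that DO touch the port cannot be split off at
  the cell level, memo `FROM-prim-l12-p1-g32-P3SHARP-DOWNSET-ANALYSIS.md`.)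
-/

namespace Summit.CriticalPhenomena.PercolationContinuityZ3.Theorems.SuperTerminalP3LamPortPart

open MeasureTheory Set Filter
open Literature.Probability.Percolation Literature.Probability.Percolation.PartitionGluing
open Literature.Probability.LatticeModels (prodBernoulli)
open SuperTerminalDownsets SuperTerminalDownsetEvents SuperTerminalP3LamDvec SuperTerminalP3LamPortPieces
open scoped Classical

variable {V : Type*} [Fintype V]

/-! ## The pairs inside `{s,a,b}` are irrelevant -/

section SabPairs
variable {s a b c : V}

/-- **For `λ ≥ 3/2` the three pairs inside `{s,a,b}` are irrelevant to `P3_λ`**: if the row holds for `w` with the pairs `sa`, `sb`, `ab`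
set to `0`, it holds for `w`.  (The terminal-only weight `w·1_{sa,sb,ab}` has no pair at the port, so its down-set vector has the
port-isolated shape and `dvec_p3lam_mul_portIsolated` glues it onto `D(w[sa,sb,ab ↦ 0])`; the product is `D(w)` by the splitting formula
and `SuperTerminalDownsetEvents.real_partLE_terminal_mul`.)  At `λ ≥ 8/5` this is contained in `SuperTerminalP3LamGluing.p3lam_of_pieces`;
the port pairs `cs`, `ca`, `cb` are NOT covered here. [this work] -/
theorem p3lam_of_sabPairs_zero {lam : ℝ} (hlam : 3 / 2 ≤ lam) (w : Sym2 V → unitInterval)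
    (hd : s ≠ a ∧ s ≠ b ∧ s ≠ c ∧ a ≠ b ∧ a ≠ c ∧ b ≠ c)
    (hrow :
      (prodBernoulli fun e => if e = s(s, a) ∨ e = s(s, b) ∨ e = s(a, b) then 0 else w e).real
          (openConn s a ∩ (openConn s b)ᶜ : Set (BondConfig V)) *
        (prodBernoulli fun e => if e = s(s, a) ∨ e = s(s, b) ∨ e = s(a, b) then 0 else w e).real
          ((openConn c s)ᶜ ∩ (openConn c a)ᶜ ∩ (openConn c b)ᶜ : Set (BondConfig V))ᶜ ≤
      lam * (prodBernoulli fun e => if e = s(s, a) ∨ e = s(s, b) ∨ e = s(a, b) then 0 else w e).real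
          (openConn s a ∩ (openConn s b)ᶜ ∩ ((openConn c s)ᶜ ∩ (openConn c a)ᶜ ∩ (openConn c b)ᶜ)ᶜ : Set (BondConfig V))) :
    (prodBernoulli w).real (openConn s a ∩ (openConn s b)ᶜ : Set (BondConfig V)) *
        (prodBernoulli w).real ((openConn c s)ᶜ ∩ (openConn c a)ᶜ ∩ (openConn c b)ᶜ : Set (BondConfig V))ᶜ ≤
      lam * (prodBernoulli w).real (openConn s a ∩ (openConn s b)ᶜ ∩ ((openConn c s)ᶜ ∩ (openConn c a)ᶜ ∩ (openConn c b)ᶜ)ᶜ : Set (BondConfig V)) := by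
  set w' : Sym2 V → unitInterval := fun e => if e = s(s, a) ∨ e = s(s, b) ∨ e = s(a, b) then 0 else w e with hw'
  set u : Sym2 V → unitInterval := fun e => if e = s(s, a) ∨ e = s(s, b) ∨ e = s(a, b) then w e else 0 with hu
  -- the three pairs are terminal pairs not at the port
  have hsab : ∀ e : Sym2 V, (e = s(s, a) ∨ e = s(s, b) ∨ e = s(a, b)) → e ∈ ({s, a, b, c} : Finset V).sym2 := by
    rintro e (rfl | rfl | rfl) <;> simp
  have hcu : ∀ x : V, x ≠ c → (u s(c, x) : ℝ) = 0 := by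
    intro x _
    have h : ¬ (s(c, x) = s(s, a) ∨ s(c, x) = s(s, b) ∨ s(c, x) = s(a, b)) := by
      rintro (h | h | h) <;> rcases Sym2.eq_iff.1 h with ⟨h1, -⟩ | ⟨h1, -⟩
      · exact hd.2.2.1 h1.symm
      · exact hd.2.2.2.2.1 h1.symm
      · exact hd.2.2.1 h1.symm
      · exact hd.2.2.2.2.2 h1.symm
      · exact hd.2.2.2.2.1 h1.symm
      · exact hd.2.2.2.2.2 h1.symm
    simp only [hu, if_neg h]
    rfl
  -- the splitting formula: `D(w) = D(w') · D(u)`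
  have hww : ∀ x y : V, x ∉ ({s, a, b, c} : Finset V) → y ∉ ({s, a, b, c} : Finset V) → (fun _ : V => ()) x ≠ (fun _ : V => ()) y →
      (w s(x, y) : ℝ) = 0 := fun _ _ _ _ h => absurd rfl h
  have hww' : ∀ x y : V, x ∉ ({s, a, b, c} : Finset V) → y ∉ ({s, a, b, c} : Finset V) → (fun _ : V => ()) x ≠ (fun _ : V => ()) y →
      (w' s(x, y) : ℝ) = 0 := fun _ _ _ _ h => absurd rfl h
  have hpiece : (fun e => if e ∈ piecePairs ({s, a, b, c} : Finset V) (fun _ : V => ()) () then w' e else 0) =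
      fun e => if e ∈ piecePairs ({s, a, b, c} : Finset V) (fun _ : V => ()) () then w e else 0 := by
    funext e
    by_cases he : e ∈ piecePairs ({s, a, b, c} : Finset V) (fun _ : V => ()) ()
    · have hne : ¬ (e = s(s, a) ∨ e = s(s, b) ∨ e = s(a, b)) := by
        intro h3
        obtain ⟨x, y, ⟨hx, -⟩, -, -, rfl⟩ := mem_piecePairs.1 he
        exact hx (Finset.mk_mem_sym2_iff.1 (hsab _ h3)).1
      simp only [if_pos he, hw', if_neg hne]
    · simp only [if_neg he]
  have nt : ∀ x y : V, x ∉ ({s, a, b, c} : Finset V) → s(x, y) ∉ ({s, a, b, c} : Finset V).sym2 := fun x y hx h =>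
    hx (Finset.mk_mem_sym2_iff.1 h).1
  have h0 : ∀ x y : V, x ∉ ({s, a, b, c} : Finset V) → x ≠ y →
      (((fun e : Sym2 V => if e ∈ ({s, a, b, c} : Finset V).sym2 then w e else 0) s(x, y) : unitInterval) : ℝ) = 0 := by
    intro x y hx _; simp [nt x y hx]
  have h0' : ∀ x y : V, x ∉ ({s, a, b, c} : Finset V) → x ≠ y →
      (((fun e : Sym2 V => if e ∈ ({s, a, b, c} : Finset V).sym2 then w' e else 0) s(x, y) : unitInterval) : ℝ) = 0 := by
    intro x y hx _; simp [nt x y hx]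
  have h0u : ∀ x y : V, x ∉ ({s, a, b, c} : Finset V) → x ≠ y → (u s(x, y) : ℝ) = 0 := by
    intro x y hx _
    have : ¬ (s(x, y) = s(s, a) ∨ s(x, y) = s(s, b) ∨ s(x, y) = s(a, b)) := fun h => nt x y hx (hsab _ h)
    simp only [hu, if_neg this]
    rfl
  have hmul : ∀ e : Sym2 V, (1 - (((fun e : Sym2 V => if e ∈ ({s, a, b, c} : Finset V).sym2 then w e else 0) e : unitInterval) : ℝ)) =
      (1 - (((fun e : Sym2 V => if e ∈ ({s, a, b, c} : Finset V).sym2 then w' e else 0) e : unitInterval) : ℝ)) * (1 - (u e : ℝ)) := by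
    intro e
    by_cases h3 : e = s(s, a) ∨ e = s(s, b) ∨ e = s(a, b)
    · simp only [if_pos (hsab e h3), hw', hu, if_pos h3]
      simp
    · by_cases hT : e ∈ ({s, a, b, c} : Finset V).sym2
      · simp only [if_pos hT, hw', hu, if_neg h3]
        simp
      · simp only [if_neg hT, hu, if_neg h3]
        simp
  have split : ∀ blk : V → ℕ, (prodBernoulli w).real (partLE ({s, a, b, c} : Finset V) blk) =
      (prodBernoulli w').real (partLE ({s, a, b, c} : Finset V) blk) * (prodBernoulli u).real (partLE ({s, a, b, c} : Finset V) blk) := by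
    intro blk
    rw [real_partLE_eq_terminalPiece_mul_prod w ({s, a, b, c} : Finset V) (fun _ : V => ()) blk hww,
      real_partLE_eq_terminalPiece_mul_prod w' ({s, a, b, c} : Finset V) (fun _ : V => ()) blk hww',
      real_partLE_terminal_mul _ u _ ({s, a, b, c} : Finset V) h0' h0u h0 hmul blk]
    simp only [Finset.univ_unique, Finset.prod_singleton, PUnit.default_eq_unit, hpiece]
    ring
  -- the row for `w'` and the laws of the two real weights
  have G' := (rowLam_iff w' lam s a b c).1 hrow
  have C' := core_of_weight w' s a b c
  have F' := face_of_weight w' hd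
  obtain ⟨q2, q3, q4, q5, q6, q7⟩ := dvec_portIsolated u hd hcu
  obtain ⟨g0, g1, -, -, -, -, -, -, -⟩ := core_of_weight u s a b c
  have step := dvec_p3lam_mul_portIsolated hlam C' G' F' q2 q3 q4 q5 q6 q7 g0 g1
  have S0 := split (fun v => if v = a then 1 else if v = b then 2 else if v = c then 3 else (0 : ℕ))
  have S1 := split (fun v => if v = b then 1 else if v = c then 2 else (0 : ℕ))
  have S2 := split (fun v => if v = b ∨ v = c then 1 else (0 : ℕ))
  have S3 := split (fun v => if v = a then 1 else if v = b ∨ v = c then 2 else (0 : ℕ))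
  have S4 := split (fun v => if v = b then 1 else (0 : ℕ))
  have S5 := split (fun v => if v = a then 1 else if v = b then 2 else (0 : ℕ))
  have S6 := split (fun v => if v = a ∨ v = c then 1 else if v = b then 2 else (0 : ℕ))
  have S7 := split (fun v => if v = c then 1 else (0 : ℕ))
  rw [partLE_blk0 hd] at S0
  rw [partLE_blk1 hd] at S1
  rw [partLE_blk2 hd] at S2
  rw [partLE_blk3 hd] at S3
  rw [partLE_blk4 hd] at S4
  rw [partLE_blk5 hd] at S5
  rw [partLE_blk6 hd] at S6
  rw [partLE_blk7 hd] at S7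
  refine (rowLam_iff w lam s a b c).2 ?_
  rw [S0, S1, S2, S3, S4, S5, S6, S7]
  exact step

end SabPairs

/-! ## The quotable form: the port part of a weight -/

section PortPart
variable {s a b c : V}

/-- **`P3_λ` (`λ ≥ 3/2`) holds for `w` as soon as it holds for the PORT PART of `w`.**  The port part `u` of `w` keeps the pairs inside
`{s,a,b,c}` and every non-loop pair with an endpoint `x ∉ {s,a,b,c}` that is joined to the port `c` by a path of pairs of non-zero weight
avoiding `{s,a,b}` (i.e. `x` lies in the `{s,a,b}`-piece of `c`), and kills every other pair.  So for every `λ ≥ 3/2` — in particular for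
the sharp row `λ = 3/2` — the components of `G ∖ {s,a,b}` not containing the port, with all their attachments to `s, a, b`, are irrelevant:
a counterexample with the fewest active vertices has `G ∖ {s,a,b}` connected.  (Proof: `p3lam_of_portPieces` for the labelling by the
connected components of the graph of non-zero non-terminal pairs, `J` = the components met by the `{s,a,b}`-piece of `c`.) [this work] -/
theorem p3lam_of_portPart {lam : ℝ} (hlam : 3 / 2 ≤ lam) (w : Sym2 V → unitInterval)
    (hd : s ≠ a ∧ s ≠ b ∧ s ≠ c ∧ a ≠ b ∧ a ≠ c ∧ b ≠ c)
    (hrow :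
      (prodBernoulli fun e => if e ∈ ({s, a, b, c} : Finset V).sym2 ∨
          ∃ x y : V, e = s(x, y) ∧ x ≠ y ∧ ¬ (x = s ∨ x = a ∨ x = b ∨ x = c) ∧
            (SimpleGraph.fromRel fun p q : V => ¬ (p = s ∨ p = a ∨ p = b) ∧ ¬ (q = s ∨ q = a ∨ q = b) ∧ (w s(p, q) : ℝ) ≠ 0).Reachable c x
          then w e else 0).real (openConn s a ∩ (openConn s b)ᶜ : Set (BondConfig V)) *
        (prodBernoulli fun e => if e ∈ ({s, a, b, c} : Finset V).sym2 ∨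
          ∃ x y : V, e = s(x, y) ∧ x ≠ y ∧ ¬ (x = s ∨ x = a ∨ x = b ∨ x = c) ∧
            (SimpleGraph.fromRel fun p q : V => ¬ (p = s ∨ p = a ∨ p = b) ∧ ¬ (q = s ∨ q = a ∨ q = b) ∧ (w s(p, q) : ℝ) ≠ 0).Reachable c x
          then w e else 0).real ((openConn c s)ᶜ ∩ (openConn c a)ᶜ ∩ (openConn c b)ᶜ : Set (BondConfig V))ᶜ ≤
      lam * (prodBernoulli fun e => if e ∈ ({s, a, b, c} : Finset V).sym2 ∨
          ∃ x y : V, e = s(x, y) ∧ x ≠ y ∧ ¬ (x = s ∨ x = a ∨ x = b ∨ x = c) ∧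
            (SimpleGraph.fromRel fun p q : V => ¬ (p = s ∨ p = a ∨ p = b) ∧ ¬ (q = s ∨ q = a ∨ q = b) ∧ (w s(p, q) : ℝ) ≠ 0).Reachable c x
          then w e else 0).real
          (openConn s a ∩ (openConn s b)ᶜ ∩ ((openConn c s)ᶜ ∩ (openConn c a)ᶜ ∩ (openConn c b)ᶜ)ᶜ : Set (BondConfig V))) :
    (prodBernoulli w).real (openConn s a ∩ (openConn s b)ᶜ : Set (BondConfig V)) *
        (prodBernoulli w).real ((openConn c s)ᶜ ∩ (openConn c a)ᶜ ∩ (openConn c b)ᶜ : Set (BondConfig V))ᶜ ≤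
      lam * (prodBernoulli w).real (openConn s a ∩ (openConn s b)ᶜ ∩ ((openConn c s)ᶜ ∩ (openConn c a)ᶜ ∩ (openConn c b)ᶜ)ᶜ : Set (BondConfig V)) := by
  have hT : ∀ x : V, x ∈ ({s, a, b, c} : Finset V) ↔ (x = s ∨ x = a ∨ x = b ∨ x = c) := fun x => by
    simp only [Finset.mem_insert, Finset.mem_singleton]
  -- the graph of non-zero non-terminal pairs (pieces) and the graph of non-zero pairs avoiding `{s,a,b}` (the port part)
  set H : SimpleGraph V := SimpleGraph.fromRel fun p q : V =>
      ¬ (p = s ∨ p = a ∨ p = b ∨ p = c) ∧ ¬ (q = s ∨ q = a ∨ q = b ∨ q = c) ∧ (w s(p, q) : ℝ) ≠ 0 with hH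
  set R : SimpleGraph V := SimpleGraph.fromRel fun p q : V =>
      ¬ (p = s ∨ p = a ∨ p = b) ∧ ¬ (q = s ∨ q = a ∨ q = b) ∧ (w s(p, q) : ℝ) ≠ 0 with hR
  haveI : Fintype H.ConnectedComponent := Fintype.ofFinite _
  have hHR : H ≤ R := by
    intro p q hpq
    rw [hH, SimpleGraph.fromRel_adj] at hpq
    rw [hR, SimpleGraph.fromRel_adj]
    refine ⟨hpq.1, ?_⟩
    rcases hpq.2 with ⟨hp, hq, hne⟩ | ⟨hq, hp, hne⟩
    · exact Or.inl ⟨fun h => hp (by tauto), fun h => hq (by tauto), hne⟩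
    · exact Or.inr ⟨fun h => hq (by tauto), fun h => hp (by tauto), hne⟩
  set part : V → H.ConnectedComponent := fun v => H.connectedComponentMk v with hpart
  have hw : ∀ x y : V, x ∉ ({s, a, b, c} : Finset V) → y ∉ ({s, a, b, c} : Finset V) → part x ≠ part y → (w s(x, y) : ℝ) = 0 := by
    intro x y hx hy hxy
    by_contra hne
    apply hxy
    simp only [hpart]
    rw [SimpleGraph.ConnectedComponent.eq]
    by_cases hxy' : x = y
    · subst hxy'; rfl
    refine SimpleGraph.Adj.reachable ?_
    rw [hH, SimpleGraph.fromRel_adj]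
    exact ⟨hxy', Or.inl ⟨fun h => hx ((hT x).2 h), fun h => hy ((hT y).2 h), hne⟩⟩
  set J : Finset H.ConnectedComponent :=
    Finset.univ.filter fun i => ∃ v : V, ¬ (v = s ∨ v = a ∨ v = b ∨ v = c) ∧ part v = i ∧ R.Reachable c v with hJdef
  have hJ : ∀ v : V, v ∉ ({s, a, b, c} : Finset V) → part v ∉ J → (w s(c, v) : ℝ) = 0 := by
    intro v hv hvJ
    by_contra hne
    apply hvJ
    rw [hJdef, Finset.mem_filter]
    refine ⟨Finset.mem_univ _, v, fun h => hv ((hT v).2 h), rfl, SimpleGraph.Adj.reachable ?_⟩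
    rw [hR, SimpleGraph.fromRel_adj]
    have hcv : c ≠ v := fun h => hv (by rw [← h]; simp)
    refine ⟨hcv, Or.inl ⟨?_, fun h => hv ((hT v).2 (by tauto)), hne⟩⟩
    rintro (h | h | h)
    · exact hd.2.2.1 h.symm
    · exact hd.2.2.2.2.1 h.symm
    · exact hd.2.2.2.2.2 h.symm
  -- the port part of `w` is the partial union `w_J`
  have hEq : (fun e : Sym2 V => if e ∈ ({s, a, b, c} : Finset V).sym2 ∨
        ∃ x y : V, e = s(x, y) ∧ x ≠ y ∧ ¬ (x = s ∨ x = a ∨ x = b ∨ x = c) ∧ R.Reachable c x then w e else 0) =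
      fun e => if e ∈ ({s, a, b, c} : Finset V).sym2 ∨ ∃ i ∈ J, e ∈ piecePairs {s, a, b, c} part i then w e else 0 := by
    funext e
    by_cases hwe : (w e : ℝ) = 0
    · have hwe' : w e = 0 := Subtype.ext hwe
      simp only [hwe']
      split_ifs <;> rfl
    have hiff : (e ∈ ({s, a, b, c} : Finset V).sym2 ∨
        ∃ x y : V, e = s(x, y) ∧ x ≠ y ∧ ¬ (x = s ∨ x = a ∨ x = b ∨ x = c) ∧ R.Reachable c x) ↔
        (e ∈ ({s, a, b, c} : Finset V).sym2 ∨ ∃ i ∈ J, e ∈ piecePairs {s, a, b, c} part i) := by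
      refine or_congr_right ⟨?_, ?_⟩
      · rintro ⟨x, y, rfl, hxy, hx, hcx⟩
        refine ⟨part x, ?_, ?_⟩
        · rw [hJdef, Finset.mem_filter]
          exact ⟨Finset.mem_univ _, x, hx, rfl, hcx⟩
        · refine mk_mem_piecePairs (fun h => hx ((hT x).1 h)) rfl ?_ hxy
          by_cases hy : y ∈ ({s, a, b, c} : Finset V)
          · exact Or.inr hy
          · refine Or.inl ⟨hy, ?_⟩
            simp only [hpart]
            rw [SimpleGraph.ConnectedComponent.eq]
            refine (SimpleGraph.Adj.reachable ?_).symm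
            rw [hH, SimpleGraph.fromRel_adj]
            exact ⟨hxy, Or.inl ⟨hx, fun h => hy ((hT y).2 h), hwe⟩⟩
      · rintro ⟨i, hi, he⟩
        rw [hJdef, Finset.mem_filter] at hi
        obtain ⟨-, v₀, hv₀, hv₀i, hcv₀⟩ := hi
        obtain ⟨x, y, ⟨hx, hxi⟩, -, hxy, rfl⟩ := mem_piecePairs.1 he
        refine ⟨x, y, rfl, hxy, fun h => hx ((hT x).2 h), hcv₀.trans ?_⟩
        have hHreach : H.Reachable v₀ x := by
          have : part v₀ = part x := hv₀i.trans hxi.symm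
          simpa only [hpart, SimpleGraph.ConnectedComponent.eq] using this
        exact hHreach.mono hHR
    simp only [hiff]
  rw [hEq] at hrow
  exact p3lam_of_portPieces hlam w hd part hw J hJ hrow

end PortPart

end Summit.CriticalPhenomena.PercolationContinuityZ3.Theorems.SuperTerminalP3LamPortPart
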